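import Summits.Ventures.YMGap.RobustBall.UniformMassGap
import Summits.Ventures.YMGap.RobustBall.MassGapOfDoor
import Summits.Ventures.YMGap.RobustBall.RowsSU2
import HarnessLib

/-!
# Venture YMGap, track ROBUST-BALL (Y2) — tier 1: the mass gap UNIFORMLY on the `ℤ^d` ball, explicit rate from the
# robust single-link door

HONEST FRAMING. WHAT THIS IS: a venture file (cell `pub-ymgap`, track Y2 ROBUST-BALL, seat rb-p1, theorems
only) closing the uniform tier-1 currency `UniformMassGapOnBallZd` of `UniformMassGap.lean` with the landed
door theorems, whose constants are explicit and member-independent: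
* `perturbedClustering_of_isKRContraction` — ANY Dobrushin contraction of the member's `SU(N)` specification over
  `perturbedNbr supp` with row sums `≤ ρ < 1` and range `R` gives `PerturbedClustering` with rate
  `m = -log max(ρ, 1/2) / max(1, R)` and constant `A = 8N / max(ρ, 1/2)` (`perturbed_covariance_decay_of_isKRContraction`,
  Föllmer's comparison with the profile `⌊dist/R₀⌋`);
* `uniformMassGapOnBallZd_of_pair` — for `d, N ≥ 1` and a one-link Poincaré/variance pair `(c, v)` on
  `‖B‖_op ≤ b ⊇ 2(d-1)|β|`: `6(d-1)|β| e^{ε₀} √(c v) + e^{ε₀/2} √c ε₁ ≤ ρ < 1 ⇒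
  UniformMassGapOnBallZd d N β ε₀ ε₁ R (-log max(ρ,½)/max(1,R)) (8N/max(ρ,½))`; the CLEAN readings
  `…_of_pair_linear` (`1/2 ≤ ρ < 1`: rate `(1-ρ)/max(1,R)`, constant `16N`, by `log x ≤ x - 1`) and
  `…_of_pair_half` (`ρ ≤ 1/2`: rate `log 2/max(1,R)`, constant `16N`);
* `SU(2)`, every `d`, hypothesis-free (sharp Poincaré constant `2/3`): `su2_uniformMassGapOnBallZd[_dim4]` —
  `2(d-1)|β_W| e^{ε₀} + e^{ε₀/2} √(2/3) ε₁ ≤ ρ`, `1/2 ≤ ρ < 1 ⇒ UniformMassGapOnBallZd d 2 (β_W/4) ε₀ ε₁ R ((1-ρ)/max(1,R)) 32`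
  — a CLOSED-FORM member-independent inverse correlation-length bound on the whole ball; numeric rows
  `su2_uniformRowA` and cells `(β_W, ε; ρ) = (1/8, 1/20; 7/8)`, `(1/10, 1/10; 7/8)`, `(1/16, 1/20; 1/2 ⇒ rate log 2/max(1,R))`
  (at the landed MAXIMAL radii, e.g. `(1/8, .097)`, the row sum is `0.998` and the certified rate `0.002/max(1,R)` — the
  edge of the ball is where the door closes),
  and the WILSON POINT `su2_wilson_clustering_upTo_oneTwelfth`: for `0 ≤ β_W ≤ 1/12` every DLR state of `SU(2)`
  lattice Yang–Mills on `ℤ⁴` clusters at rate `≥ log 2` with constant `32 n²` (the zero member);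
* every `N ≥ 2` (Bakry–Émery pair, hypothesis-free): `suN_uniformMassGapOnBallZd_bakryEmery`.
Every uniform row re-proves its landed pointwise row through `UniformMassGapOnBallZd.massGapOnBallZd`.
WHAT THIS IS NOT: the rates are LOWER bounds on the inverse correlation length produced by the Dobrushin
comparison (they vanish linearly at the door's threshold `ρ → 1` and are divided by the range `R`); strong-coupling
LATTICE statements, nothing about the continuum limit or a Clay-sense mass gap.
-/

noncomputable section

open MeasureTheory Filter Function ProbabilityTheory Real Topology
open scoped NNReal
open Literature.Probability.LatticeModels
open Literature.Probability.LatticeModels.DobrushinMetric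
open Literature.MathematicalPhysics.QuantumLattice
open Literature.MathematicalPhysics.QuantumFieldTheory hiding ZdEdge Site
open Summit.QuantumFields.BalabanUV.InfraRed.StrongCouplingPoincareDoorSUN (OneLinkPoincareSUN
  oneLinkPoincareSUN_two_sharp oneLinkPoincareSUN_bakryEmery)
open Summit.QuantumFields.BalabanUV.InfraRed.StrongCouplingVarianceDoorSUN (OneLinkVarianceBound
  oneLinkVarianceBound_bakryEmery)

namespace Summit.Ventures.YMGap.RobustBall

variable {d N : ℕ}

/-! ### The member: explicit clustering data from any Dobrushin contraction -/

/-- **Explicit clustering data from ANY robust door**: an `IsKRContraction` of the member's `SU(N)` specification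
over `perturbedNbr supp` with row sums `≤ ρ < 1`, for a member of range `R`, gives `PerturbedClustering` with rate
`-log max(ρ, 1/2)/max(1, R)` and constant `8N/max(ρ, 1/2)` (`perturbed_covariance_decay_of_isKRContraction`:
`c₁ = 2(2√N)² n² e^{κ}`, `κ = -log max(ρ,1/2)`, `e^{κ} = 1/max(ρ,1/2)`). [folklore] -/
theorem perturbedClustering_of_isKRContraction {β ρ R : ℝ}
    {W : Potential (ZdEdge d) (Matrix.specialUnitaryGroup (Fin N) ℂ)} (hW : W.IsAdapted)
    (hWb : ∀ X, ∃ C, ∀ U, |W X U| ≤ C)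
    {supp : Finset (ZdEdge d) → Finset (Finset (ZdEdge d))} (hsupp : W.IsSupportedBy supp)
    {C : ZdEdge d → ZdEdge d → ℝ}
    (hKR : IsKRContraction (perturbedYM (d := d) (fundamentalRep (Fin N)) (N * β) W supp) suFrobDist
      (perturbedNbr supp) C)
    (hrow : ∀ x, ∑ y ∈ perturbedNbr supp x, C x y ≤ ρ) (hρ : ρ < 1)
    (hR : ∀ e, ∀ X ∈ supp {e}, e ∈ X → ∀ y ∈ X, ‖e.1 - y.1‖ ≤ R) :
    PerturbedClustering d N β W supp (-Real.log (max ρ (1 / 2)) / max 1 R) (8 * N / max ρ (1 / 2)) := by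
  intro μ hμ n F₁ F₂ Λ₁ Λ₂ K₁ K₂ h₁ h₂ hdj hF₁ hF₂
  have hc'0 : 0 < max ρ (1 / 2) := lt_max_of_lt_right (by norm_num)
  have key := perturbed_covariance_decay_of_isKRContraction hW hWb hsupp hKR hrow hρ hR μ hμ n F₁ F₂ Λ₁ Λ₂ K₁ K₂
    h₁ h₂ hdj hF₁ hF₂
  have e1 : (2 * (2 * Real.sqrt N) ^ 2 * (n : ℝ) ^ 2 * exp (-Real.log (max ρ (1 / 2))) : ℝ) =
      8 * N / max ρ (1 / 2) * (n : ℝ) ^ 2 := by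
    rw [Real.exp_neg, Real.exp_log hc'0, mul_pow, Real.sq_sqrt (Nat.cast_nonneg _)]
    field_simp
    ring
  rw [e1] at key
  exact key

/-! ### The ball: uniform mass gap from a one-link pair -/

/-- **MASS GAP UNIFORMLY ON THE TIER-1 BALL from a one-link pair, explicit rate**: for `d, N ≥ 1`, a 't Hooft
coupling `β`, a Poincaré/variance pair `(c, v)` of the unperturbed `SU(N)` one-link family on `‖B‖_op ≤ b`,
`b ≥ 2(d-1)|β|`, and `6(d-1)|β| e^{ε₀} √(c v) + e^{ε₀/2} √c ε₁ ≤ ρ < 1`: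
`UniformMassGapOnBallZd d N β ε₀ ε₁ R (-log max(ρ,½)/max(1,R)) (8N/max(ρ,½))` — every member of `MemBallZd ε₀ ε₁ R`
has exactly one DLR state (`subsingleton_perturbedGibbsMeasures_SU`, `perturbedGibbsMeasures_nonempty`) and every
DLR state clusters with THIS rate and THIS constant (`isKRContraction_perturbedYM_SU`, `sum_perturbedNbr_coeff_le`,
`perturbedClustering_of_isKRContraction`). [folklore] -/
theorem uniformMassGapOnBallZd_of_pair (hd : 1 ≤ d) (hN : 1 ≤ N) {β b c v ε₀ ε₁ ρ : ℝ} (R : ℝ) (hc : 0 ≤ c)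
    (hv : 0 ≤ v) (hb : |β| * (2 * ((d : ℝ) - 1)) ≤ b)
    (hP : ∀ B : Matrix (Fin N) (Fin N) ℂ, matrixOpNorm B ≤ b →
      ∀ (ψ : Matrix.specialUnitaryGroup (Fin N) ℂ → ℝ) (M : ℝ), 0 ≤ M →
        (∀ x y, |ψ x - ψ y| ≤ M * suFrobDist x y) →
        Var[ψ; (haarProbability (Matrix.specialUnitaryGroup (Fin N) ℂ)).tilted
          fun g => (N : ℝ) * ((g : Matrix (Fin N) (Fin N) ℂ) * B).trace.re] ≤ c * M ^ 2)
    (hVB : ∀ B : Matrix (Fin N) (Fin N) ℂ, matrixOpNorm B ≤ b → ∀ Δ : Matrix (Fin N) (Fin N) ℂ,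
      Var[fun g : Matrix.specialUnitaryGroup (Fin N) ℂ =>
          (N : ℝ) * ((g : Matrix (Fin N) (Fin N) ℂ) * Δ).trace.re;
        (haarProbability (Matrix.specialUnitaryGroup (Fin N) ℂ)).tilted
          fun g => (N : ℝ) * ((g : Matrix (Fin N) (Fin N) ℂ) * B).trace.re] ≤ v * frobNorm Δ ^ 2)
    (hρ : 6 * ((d : ℝ) - 1) * |β| * (exp ε₀ * Real.sqrt (c * v)) + exp (ε₀ / 2) * Real.sqrt c * ε₁ ≤ ρ)
    (hρ1 : ρ < 1) :
    UniformMassGapOnBallZd d N β ε₀ ε₁ R (-Real.log (max ρ (1 / 2)) / max 1 R) (8 * N / max ρ (1 / 2)) := by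
  haveI : SecondCountableTopology (Matrix (Fin N) (Fin N) ℂ) :=
    inferInstanceAs (SecondCountableTopology (Fin N → Fin N → ℂ))
  haveI : SecondCountableTopology (Matrix.specialUnitaryGroup (Fin N) ℂ) :=
    Topology.IsEmbedding.subtypeVal.secondCountableTopology
  have hc'0 : 0 < max ρ (1 / 2) := lt_max_of_lt_right (by norm_num)
  have hc'1 : max ρ (1 / 2) < 1 := max_lt hρ1 (by norm_num)
  have hκ0 : 0 < -Real.log (max ρ (1 / 2)) := neg_pos.2 (Real.log_neg hc'0 hc'1)
  have hR₀ : 0 < max 1 R := zero_lt_one.trans_le (le_max_left _ _)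
  refine ⟨div_pos hκ0 hR₀, fun W supp hmem => ?_⟩
  obtain ⟨osc, lip, hosc, hlip, hosca, hΛ⟩ := hmem.loads
  have hW : W.IsAdapted := fun X => ⟨hmem.dependsOn X, (hmem.continuous X).measurable⟩
  have hWb : ∀ X, ∃ C, ∀ U, |W X U| ≤ C := fun X => exists_bound_of_continuous (hmem.continuous X)
  have hlt : 6 * ((d : ℝ) - 1) * |β| * (exp ε₀ * Real.sqrt (c * v)) + exp (ε₀ / 2) * Real.sqrt c * ε₁ < 1 :=
    hρ.trans_lt hρ1
  have hKR := isKRContraction_perturbedYM_SU hd hN hc hv hb hP hVB hW (supp := supp) hosc hosca hlip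
  have hrow : ∀ x, ∑ y ∈ perturbedNbr supp x,
      (exp ε₀ * Real.sqrt (c * v) * |β| * linkInfluence x y +
        exp (ε₀ / 2) * Real.sqrt c * ∑ X ∈ (supp {x}).filter (fun X => x ∈ X), lip X y) ≤ ρ :=
    fun x => (sum_perturbedNbr_coeff_le hd (β := β) (c := c) (v := v) (a := ε₀) hΛ x).trans hρ
  exact ⟨⟨subsingleton_perturbedGibbsMeasures_SU hd hN hc hv hb hP hVB hW hWb hmem.supportedBy hosc hosca hlip hΛ
      hlt, perturbedGibbsMeasures_nonempty _ (continuous_fundamentalRep (Fin N)) _ hmem.continuous hmem.dependsOn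
      hmem.supportedBy⟩,
    perturbedClustering_of_isKRContraction hW hWb hmem.supportedBy hKR hrow hρ1 hmem.range⟩

/-- **Clean reading, `1/2 ≤ ρ < 1`**: rate `(1 - ρ)/max(1, R)`, constant `16N` (`-log ρ ≥ 1 - ρ`,
`Real.log_le_sub_one_of_pos`; `8N/ρ ≤ 16N`). [folklore] -/
theorem uniformMassGapOnBallZd_of_pair_linear (hd : 1 ≤ d) (hN : 1 ≤ N) {β b c v ε₀ ε₁ ρ : ℝ} (R : ℝ)
    (hc : 0 ≤ c) (hv : 0 ≤ v) (hb : |β| * (2 * ((d : ℝ) - 1)) ≤ b)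
    (hP : ∀ B : Matrix (Fin N) (Fin N) ℂ, matrixOpNorm B ≤ b →
      ∀ (ψ : Matrix.specialUnitaryGroup (Fin N) ℂ → ℝ) (M : ℝ), 0 ≤ M →
        (∀ x y, |ψ x - ψ y| ≤ M * suFrobDist x y) →
        Var[ψ; (haarProbability (Matrix.specialUnitaryGroup (Fin N) ℂ)).tilted
          fun g => (N : ℝ) * ((g : Matrix (Fin N) (Fin N) ℂ) * B).trace.re] ≤ c * M ^ 2)
    (hVB : ∀ B : Matrix (Fin N) (Fin N) ℂ, matrixOpNorm B ≤ b → ∀ Δ : Matrix (Fin N) (Fin N) ℂ,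
      Var[fun g : Matrix.specialUnitaryGroup (Fin N) ℂ =>
          (N : ℝ) * ((g : Matrix (Fin N) (Fin N) ℂ) * Δ).trace.re;
        (haarProbability (Matrix.specialUnitaryGroup (Fin N) ℂ)).tilted
          fun g => (N : ℝ) * ((g : Matrix (Fin N) (Fin N) ℂ) * B).trace.re] ≤ v * frobNorm Δ ^ 2)
    (hρ : 6 * ((d : ℝ) - 1) * |β| * (exp ε₀ * Real.sqrt (c * v)) + exp (ε₀ / 2) * Real.sqrt c * ε₁ ≤ ρ)
    (hhalf : 1 / 2 ≤ ρ) (hρ1 : ρ < 1) :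
    UniformMassGapOnBallZd d N β ε₀ ε₁ R ((1 - ρ) / max 1 R) (16 * N) := by
  have h := uniformMassGapOnBallZd_of_pair hd hN R hc hv hb hP hVB hρ hρ1
  have hmax : max ρ (1 / 2) = ρ := max_eq_left hhalf
  rw [hmax] at h
  have hρ0 : 0 < ρ := by linarith
  have hR₀ : 0 < max 1 R := zero_lt_one.trans_le (le_max_left _ _)
  have hN0 : (0 : ℝ) ≤ N := Nat.cast_nonneg _
  refine h.mono le_rfl le_rfl le_rfl (div_pos (by linarith) hR₀)
    (div_le_div_of_nonneg_right (by linarith [Real.log_le_sub_one_of_pos hρ0]) hR₀.le) ?_ (by positivity)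
  rw [div_le_iff₀ hρ0]
  nlinarith

/-- **Clean reading, `ρ ≤ 1/2`**: rate `log 2/max(1, R)`, constant `16N` (`max(ρ, ½) = ½`). [folklore] -/
theorem uniformMassGapOnBallZd_of_pair_half (hd : 1 ≤ d) (hN : 1 ≤ N) {β b c v ε₀ ε₁ ρ : ℝ} (R : ℝ)
    (hc : 0 ≤ c) (hv : 0 ≤ v) (hb : |β| * (2 * ((d : ℝ) - 1)) ≤ b)
    (hP : ∀ B : Matrix (Fin N) (Fin N) ℂ, matrixOpNorm B ≤ b →
      ∀ (ψ : Matrix.specialUnitaryGroup (Fin N) ℂ → ℝ) (M : ℝ), 0 ≤ M →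
        (∀ x y, |ψ x - ψ y| ≤ M * suFrobDist x y) →
        Var[ψ; (haarProbability (Matrix.specialUnitaryGroup (Fin N) ℂ)).tilted
          fun g => (N : ℝ) * ((g : Matrix (Fin N) (Fin N) ℂ) * B).trace.re] ≤ c * M ^ 2)
    (hVB : ∀ B : Matrix (Fin N) (Fin N) ℂ, matrixOpNorm B ≤ b → ∀ Δ : Matrix (Fin N) (Fin N) ℂ,
      Var[fun g : Matrix.specialUnitaryGroup (Fin N) ℂ =>
          (N : ℝ) * ((g : Matrix (Fin N) (Fin N) ℂ) * Δ).trace.re;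
        (haarProbability (Matrix.specialUnitaryGroup (Fin N) ℂ)).tilted
          fun g => (N : ℝ) * ((g : Matrix (Fin N) (Fin N) ℂ) * B).trace.re] ≤ v * frobNorm Δ ^ 2)
    (hρ : 6 * ((d : ℝ) - 1) * |β| * (exp ε₀ * Real.sqrt (c * v)) + exp (ε₀ / 2) * Real.sqrt c * ε₁ ≤ ρ)
    (hhalf : ρ ≤ 1 / 2) :
    UniformMassGapOnBallZd d N β ε₀ ε₁ R (Real.log 2 / max 1 R) (16 * N) := by
  have h := uniformMassGapOnBallZd_of_pair hd hN R hc hv hb hP hVB hρ (by linarith)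
  have hmax : max ρ (1 / 2) = 1 / 2 := max_eq_right hhalf
  have hlog : -Real.log (1 / 2 : ℝ) = Real.log 2 := by
    rw [one_div, Real.log_inv, neg_neg]
  rw [hmax, hlog] at h
  have h16 : (8 * (N : ℝ) / (1 / 2) : ℝ) = 16 * N := by ring
  rwa [h16] at h

/-! ### `SU(2)`: the closed-form uniform rate on the ball, hypothesis-free -/

/-- **UNIFORM MASS GAP ON THE `SU(2)` BALL, every `d ≥ 1`, CLOSED FORM** (sharp Poincaré constant `2/3` at every
drift, `v = 8/3`; 't Hooft `β = β_W/4`): if `2(d-1)|β_W| e^{ε₀} + e^{ε₀/2} √(2/3) ε₁ ≤ ρ` with `1/2 ≤ ρ < 1`, then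
`UniformMassGapOnBallZd d 2 (β_W/4) ε₀ ε₁ R ((1-ρ)/max(1,R)) 32`: EVERY member of `MemBallZd ε₀ ε₁ R` has one DLR
state whose connected correlations decay at rate `≥ (1-ρ)/max(1,R)` with constant `32 n²`. [folklore] -/
theorem su2_uniformMassGapOnBallZd (hd : 1 ≤ d) {βW ε₀ ε₁ ρ : ℝ} (R : ℝ)
    (hρ : 2 * ((d : ℝ) - 1) * |βW| * exp ε₀ + exp (ε₀ / 2) * Real.sqrt (2 / 3) * ε₁ ≤ ρ) (hhalf : 1 / 2 ≤ ρ)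
    (hρ1 : ρ < 1) : UniformMassGapOnBallZd d 2 (βW / 4) ε₀ ε₁ R ((1 - ρ) / max 1 R) 32 := by
  have hc : (0 : ℝ) ≤ 2 / 3 := by norm_num
  have hP : ∀ B : Matrix (Fin 2) (Fin 2) ℂ, matrixOpNorm B ≤ |βW / 4| * (2 * ((d : ℝ) - 1)) →
      ∀ (ψ : Matrix.specialUnitaryGroup (Fin 2) ℂ → ℝ) (M : ℝ), 0 ≤ M →
        (∀ x y, |ψ x - ψ y| ≤ M * suFrobDist x y) →
        Var[ψ; (haarProbability (Matrix.specialUnitaryGroup (Fin 2) ℂ)).tilted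
          fun g => ((2 : ℕ) : ℝ) * ((g : Matrix (Fin 2) (Fin 2) ℂ) * B).trace.re] ≤ 2 / 3 * M ^ 2 :=
    fun B hB ψ M hM hψ => oneLinkPoincareSUN_two_sharp _ B hB ψ M hM hψ
  have hVB := linVariance_of_poincare (N := 2) hP
  have hv : (0 : ℝ) ≤ 2 / 3 * ((2 : ℕ) : ℝ) ^ 2 := by norm_num
  have h32 : (16 * ((2 : ℕ) : ℝ) : ℝ) = 32 := by norm_num
  rw [← h32]
  refine uniformMassGapOnBallZd_of_pair_linear hd (by norm_num) R hc hv le_rfl hP hVB ?_ hhalf hρ1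
  have hsq : Real.sqrt (2 / 3 * (2 / 3 * ((2 : ℕ) : ℝ) ^ 2)) = 4 / 3 := by
    rw [show (2 / 3 * (2 / 3 * ((2 : ℕ) : ℝ) ^ 2) : ℝ) = (4 / 3) ^ 2 by norm_num, Real.sqrt_sq (by norm_num)]
  rw [hsq]
  have e : 6 * ((d : ℝ) - 1) * |βW / 4| * (exp ε₀ * (4 / 3)) = 2 * ((d : ℝ) - 1) * |βW| * exp ε₀ := by
    rw [abs_div, abs_of_pos (by norm_num : (0 : ℝ) < 4)]
    ring
  rw [e]
  exact hρ

/-- The `d = 4` reading: `6|β_W| e^{ε₀} + e^{ε₀/2} √(2/3) ε₁ ≤ ρ`, `1/2 ≤ ρ < 1`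
`⇒ UniformMassGapOnBallZd 4 2 (β_W/4) ε₀ ε₁ R ((1-ρ)/max(1,R)) 32`. [folklore] -/
theorem su2_uniformMassGapOnBallZd_dim4 {βW ε₀ ε₁ ρ : ℝ} (R : ℝ)
    (hρ : 6 * |βW| * exp ε₀ + exp (ε₀ / 2) * Real.sqrt (2 / 3) * ε₁ ≤ ρ) (hhalf : 1 / 2 ≤ ρ) (hρ1 : ρ < 1) :
    UniformMassGapOnBallZd 4 2 (βW / 4) ε₀ ε₁ R ((1 - ρ) / max 1 R) 32 :=
  su2_uniformMassGapOnBallZd (by norm_num) R (by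
    have h6 : (2 : ℝ) * (((4 : ℕ) : ℝ) - 1) = 6 := by norm_num
    rw [h6]; exact hρ) hhalf hρ1

/-- **`SU(2)`, `d = 4`, small row sums**: `6|β_W| e^{ε₀} + e^{ε₀/2} √(2/3) ε₁ ≤ 1/2 ⇒` rate `log 2/max(1,R)`,
constant `32`. [folklore] -/
theorem su2_uniformMassGapOnBallZd_dim4_half {βW ε₀ ε₁ : ℝ} (R : ℝ)
    (hρ : 6 * |βW| * exp ε₀ + exp (ε₀ / 2) * Real.sqrt (2 / 3) * ε₁ ≤ 1 / 2) :
    UniformMassGapOnBallZd 4 2 (βW / 4) ε₀ ε₁ R (Real.log 2 / max 1 R) 32 := by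
  have hc : (0 : ℝ) ≤ 2 / 3 := by norm_num
  have hP : ∀ B : Matrix (Fin 2) (Fin 2) ℂ, matrixOpNorm B ≤ |βW / 4| * (2 * (((4 : ℕ) : ℝ) - 1)) →
      ∀ (ψ : Matrix.specialUnitaryGroup (Fin 2) ℂ → ℝ) (M : ℝ), 0 ≤ M →
        (∀ x y, |ψ x - ψ y| ≤ M * suFrobDist x y) →
        Var[ψ; (haarProbability (Matrix.specialUnitaryGroup (Fin 2) ℂ)).tilted
          fun g => ((2 : ℕ) : ℝ) * ((g : Matrix (Fin 2) (Fin 2) ℂ) * B).trace.re] ≤ 2 / 3 * M ^ 2 :=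
    fun B hB ψ M hM hψ => oneLinkPoincareSUN_two_sharp _ B hB ψ M hM hψ
  have hVB := linVariance_of_poincare (N := 2) hP
  have hv : (0 : ℝ) ≤ 2 / 3 * ((2 : ℕ) : ℝ) ^ 2 := by norm_num
  have h32 : (16 * ((2 : ℕ) : ℝ) : ℝ) = 32 := by norm_num
  rw [← h32]
  refine uniformMassGapOnBallZd_of_pair_half (d := 4) (by norm_num) (by norm_num) R hc hv le_rfl hP hVB ?_ le_rfl
  have hsq : Real.sqrt (2 / 3 * (2 / 3 * ((2 : ℕ) : ℝ) ^ 2)) = 4 / 3 := by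
    rw [show (2 / 3 * (2 / 3 * ((2 : ℕ) : ℝ) ^ 2) : ℝ) = (4 / 3) ^ 2 by norm_num, Real.sqrt_sq (by norm_num)]
  rw [hsq]
  have e : 6 * (((4 : ℕ) : ℝ) - 1) * |βW / 4| * (exp ε₀ * (4 / 3)) = 6 * |βW| * exp ε₀ := by
    rw [abs_div, abs_of_pos (by norm_num : (0 : ℝ) < 4)]
    ring
  rw [e]
  exact hρ

/-! ### Numeric rows (`ℤ⁴`, one-parameter ball `(ε₀, ε₁) = (2ε, ε)`) -/

/-- **Uniform lineage-(A) row from the numeric majorants** (`T` = `exp_le_taylor4`, `√(2/3) ≤ 0.8165`): for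
`0 ≤ β_W`, `0 ≤ ε ≤ 1/2` and `6 β_W T(2ε) + T(ε)·0.8165·ε ≤ ρ`, `1/2 ≤ ρ < 1`:
`UniformMassGapOnBallZd 4 2 (β_W/4) (2ε) ε R ((1-ρ)/max(1,R)) 32`. [folklore] -/
theorem su2_uniformRowA {βW ε ρ : ℝ} (R : ℝ) (hβ : 0 ≤ βW) (hε0 : 0 ≤ ε) (hε1 : ε ≤ 1 / 2)
    (h : 6 * βW * (1 + 2 * ε + (2 * ε) ^ 2 / 2 + (2 * ε) ^ 3 / 6 + 5 / 96 * (2 * ε) ^ 4) +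
      (1 + ε + ε ^ 2 / 2 + ε ^ 3 / 6 + 5 / 96 * ε ^ 4) * (8165 / 10000) * ε ≤ ρ)
    (hhalf : 1 / 2 ≤ ρ) (hρ1 : ρ < 1) :
    UniformMassGapOnBallZd 4 2 (βW / 4) (2 * ε) ε R ((1 - ρ) / max 1 R) 32 := by
  refine su2_uniformMassGapOnBallZd_dim4 R ?_ hhalf hρ1
  have h1 := exp_le_taylor4 (x := 2 * ε) (by linarith) (by linarith)
  have h2 := exp_le_taylor4 (x := ε) hε0 (by linarith)
  rw [abs_of_nonneg hβ, show 2 * ε / 2 = ε by ring]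
  calc 6 * βW * exp (2 * ε) + exp ε * Real.sqrt (2 / 3) * ε
      ≤ 6 * βW * (1 + 2 * ε + (2 * ε) ^ 2 / 2 + (2 * ε) ^ 3 / 6 + 5 / 96 * (2 * ε) ^ 4) +
        (1 + ε + ε ^ 2 / 2 + ε ^ 3 / 6 + 5 / 96 * ε ^ 4) * (8165 / 10000) * ε := by
        gcongr
        · exact sqrt_two_thirds_le
    _ ≤ ρ := h

/-- The same below one half: `6 β_W T(2ε) + T(ε)·0.8165·ε ≤ 1/2 ⇒` rate `log 2/max(1,R)`, constant `32`. [folklore] -/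
theorem su2_uniformRowA_half {βW ε : ℝ} (R : ℝ) (hβ : 0 ≤ βW) (hε0 : 0 ≤ ε) (hε1 : ε ≤ 1 / 2)
    (h : 6 * βW * (1 + 2 * ε + (2 * ε) ^ 2 / 2 + (2 * ε) ^ 3 / 6 + 5 / 96 * (2 * ε) ^ 4) +
      (1 + ε + ε ^ 2 / 2 + ε ^ 3 / 6 + 5 / 96 * ε ^ 4) * (8165 / 10000) * ε ≤ 1 / 2) :
    UniformMassGapOnBallZd 4 2 (βW / 4) (2 * ε) ε R (Real.log 2 / max 1 R) 32 := by
  refine su2_uniformMassGapOnBallZd_dim4_half R ?_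
  have h1 := exp_le_taylor4 (x := 2 * ε) (by linarith) (by linarith)
  have h2 := exp_le_taylor4 (x := ε) hε0 (by linarith)
  rw [abs_of_nonneg hβ, show 2 * ε / 2 = ε by ring]
  calc 6 * βW * exp (2 * ε) + exp ε * Real.sqrt (2 / 3) * ε
      ≤ 6 * βW * (1 + 2 * ε + (2 * ε) ^ 2 / 2 + (2 * ε) ^ 3 / 6 + 5 / 96 * (2 * ε) ^ 4) +
        (1 + ε + ε ^ 2 / 2 + ε ^ 3 / 6 + 5 / 96 * ε ^ 4) * (8165 / 10000) * ε := by
        gcongr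
        · exact sqrt_two_thirds_le
    _ ≤ 1 / 2 := h

/-- **Cell `(β_W, ε) = (1/8, 1/20)`**: row sum `≤ 7/8` ⇒ on `MemBallZd (1/10) (1/20) R` at `β_W = 1/8` EVERY member's DLR
state is unique and clusters at rate `(1/8)/max(1,R)` with constant `32 n²`. [folklore] -/
theorem su2_uniformRowA_1_8 (R : ℝ) :
    UniformMassGapOnBallZd 4 2 ((1 / 8 : ℝ) / 4) (2 * (1 / 20)) (1 / 20) R ((1 - 7 / 8) / max 1 R) 32 :=
  su2_uniformRowA R (by norm_num) (by norm_num) (by norm_num) (by norm_num) (by norm_num) (by norm_num)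

/-- **Cell `(β_W, ε) = (1/10, 1/10)`**: row sum `≤ 7/8` ⇒ rate `(1/8)/max(1,R)`, constant `32 n²`. [folklore] -/
theorem su2_uniformRowA_1_10 (R : ℝ) :
    UniformMassGapOnBallZd 4 2 ((1 / 10 : ℝ) / 4) (2 * (1 / 10)) (1 / 10) R ((1 - 7 / 8) / max 1 R) 32 :=
  su2_uniformRowA R (by norm_num) (by norm_num) (by norm_num) (by norm_num) (by norm_num) (by norm_num)

/-- **Cell `(β_W, ε) = (1/16, 1/20)`**: row sum `≤ 1/2` ⇒ rate `log 2/max(1,R)` (`> 0.693/max(1,R)`), constant `32 n²`. [folklore] -/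
theorem su2_uniformRowA_1_16_half (R : ℝ) :
    UniformMassGapOnBallZd 4 2 ((1 / 16 : ℝ) / 4) (2 * (1 / 20)) (1 / 20) R (Real.log 2 / max 1 R) 32 :=
  su2_uniformRowA_half R (by norm_num) (by norm_num) (by norm_num) (by norm_num)

/-! ### The Wilson point: an explicit clustering rate for every DLR state of `SU(2)` on `ℤ⁴` -/

/-- **THE WILSON POINT, EXPLICIT RATE**: for `0 ≤ β_W ≤ 1/12`, EVERY DLR state of `SU(2)` lattice Yang–Mills on `ℤ⁴`
(bare coupling `β_W/2`, 't Hooft `β_W/4`; the zero member of the ball) clusters exponentially at rate `≥ log 2` per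
lattice unit with constant `32 n²`: `PerturbedClustering 4 2 (β_W/4) 0 (fun _ => ∅) (log 2) 32` (row sum `6β_W ≤ 1/2`).
[folklore] -/
theorem su2_wilson_clustering_upTo_oneTwelfth {βW : ℝ} (h0 : 0 ≤ βW) (h : βW ≤ 1 / 12) :
    PerturbedClustering 4 2 (βW / 4) 0 (fun _ => (∅ : Finset (Finset (ZdEdge 4)))) (Real.log 2) 32 := by
  have hball : UniformMassGapOnBallZd 4 2 (βW / 4) 0 0 0 (Real.log 2 / max 1 0) 32 :=
    su2_uniformMassGapOnBallZd_dim4_half 0 (by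
      rw [abs_of_nonneg h0, Real.exp_zero, zero_div, Real.exp_zero]
      linarith)
  have hmax : (Real.log 2 / max 1 0 : ℝ) = Real.log 2 := by rw [max_eq_left zero_le_one, div_one]
  rw [hmax] at hball
  exact hball.clustering_wilson le_rfl le_rfl

/-- The same for `0 ≤ β_W < 1/6` with the linear rate `1 - 6β_W` (row sum `6β_W ≥ 1/2`): every DLR state of `SU(2)`
on `ℤ⁴` at `1/12 ≤ β_W < 1/6` clusters at rate `≥ 1 - 6β_W` with constant `32 n²`. [folklore] -/
theorem su2_wilson_clustering_lt_oneSixth {βW : ℝ} (h0 : 1 / 12 ≤ βW) (h : βW < 1 / 6) :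
    PerturbedClustering 4 2 (βW / 4) 0 (fun _ => (∅ : Finset (Finset (ZdEdge 4)))) (1 - 6 * βW) 32 := by
  have hball : UniformMassGapOnBallZd 4 2 (βW / 4) 0 0 0 ((1 - 6 * βW) / max 1 0) 32 :=
    su2_uniformMassGapOnBallZd_dim4 0 (ρ := 6 * βW) (by
      rw [abs_of_nonneg (by linarith), Real.exp_zero, zero_div, Real.exp_zero]
      linarith) (by linarith) (by linarith)
  have hmax : ((1 - 6 * βW) / max 1 0 : ℝ) = 1 - 6 * βW := by rw [max_eq_left zero_le_one, div_one]
  rw [hmax] at hball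
  exact hball.clustering_wilson le_rfl le_rfl

/-! ### Every `N ≥ 2`: the Bakry–Émery pair, hypothesis-free -/

/-- **ALL `N ≥ 2`, EVERY `d ≥ 1`, HYPOTHESIS-FREE — uniform tier-1 mass gap from the Bakry–Émery one-link pair**
(`oneLinkPoincareSUN_bakryEmery`, `oneLinkVarianceBound_bakryEmery`; `b = 2(d-1)|β| < 1/2`):
`6(d-1)|β| e^{ε₀}/(1/2 - b) + e^{ε₀/2} ε₁/√(N(1/2 - b)) ≤ ρ`, `1/2 ≤ ρ < 1`
`⇒ UniformMassGapOnBallZd d N β ε₀ ε₁ R ((1-ρ)/max(1,R)) (16N)`. [folklore] -/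
theorem suN_uniformMassGapOnBallZd_bakryEmery (hd : 1 ≤ d) (hN : 2 ≤ N) {β ε₀ ε₁ ρ : ℝ} (R : ℝ)
    (hb : |β| * (2 * ((d : ℝ) - 1)) < 1 / 2)
    (hρ : 6 * ((d : ℝ) - 1) * |β| * exp ε₀ / (1 / 2 - |β| * (2 * ((d : ℝ) - 1))) +
      exp (ε₀ / 2) * ε₁ / Real.sqrt ((N : ℝ) * (1 / 2 - |β| * (2 * ((d : ℝ) - 1)))) ≤ ρ)
    (hhalf : 1 / 2 ≤ ρ) (hρ1 : ρ < 1) :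
    UniformMassGapOnBallZd d N β ε₀ ε₁ R ((1 - ρ) / max 1 R) (16 * N) := by
  set b : ℝ := |β| * (2 * ((d : ℝ) - 1)) with hbdef
  have hNpos : (0 : ℝ) < N := by exact_mod_cast (show 0 < N by omega)
  have hgap : 0 < 1 / 2 - b := by linarith
  have hP := oneLinkPoincareSUN_bakryEmery hN hb
  have hV := oneLinkVarianceBound_bakryEmery hN hb
  have hc : (0 : ℝ) ≤ 1 / ((N : ℝ) * (1 / 2 - b)) := by positivity
  have hv : (0 : ℝ) ≤ (N : ℝ) / (1 / 2 - b) := by positivity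
  refine uniformMassGapOnBallZd_of_pair_linear hd (by omega) R hc hv le_rfl (fun B hB => hP B hB)
    (fun B hB => hV B hB) ?_ hhalf hρ1
  have hsq1 : Real.sqrt (1 / ((N : ℝ) * (1 / 2 - b)) * ((N : ℝ) / (1 / 2 - b))) = 1 / (1 / 2 - b) := by
    rw [show 1 / ((N : ℝ) * (1 / 2 - b)) * ((N : ℝ) / (1 / 2 - b)) = (1 / (1 / 2 - b)) ^ 2 by field_simp,
      Real.sqrt_sq (by positivity)]
  have hsq2 : Real.sqrt (1 / ((N : ℝ) * (1 / 2 - b))) = 1 / Real.sqrt ((N : ℝ) * (1 / 2 - b)) := by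
    rw [Real.sqrt_div' _ (mul_nonneg hNpos.le hgap.le), Real.sqrt_one]
  rw [hsq1, hsq2]
  calc 6 * ((d : ℝ) - 1) * |β| * (exp ε₀ * (1 / (1 / 2 - b))) + exp (ε₀ / 2) * (1 / Real.sqrt ((N : ℝ) * (1 / 2 - b))) * ε₁
      = 6 * ((d : ℝ) - 1) * |β| * exp ε₀ / (1 / 2 - b) + exp (ε₀ / 2) * ε₁ / Real.sqrt ((N : ℝ) * (1 / 2 - b)) := by
        ring
    _ ≤ ρ := hρ

end Summit.Ventures.YMGap.RobustBall

end
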